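import Mathlib

/-!
# Shirshov's Lemma (Kanel-Belov–Karasik–Rowen 2015, Lemma 2.3.1) via hyperwords

Topic `Literature/Algebra/PolynomialIdentities`.  Consumer: the registered stub
`stub_shirshovLemma` of line `shirshov-split` of the crux `TightWindows`
(stmt-MatrixMultiplication-18939, route `MatrixPointInterpolation` of `MatrixMultiplication`;
file `…/Theorems/MatrixPointInterpolationTightWindowsStubShirshovLemma.lean`), which is
`shirshov_lemma` below verbatim — Branch I of that line is the windowed Shirshov–Kurosh
argument, whose only combinatorial input is this lemma.

**Shirshov's Lemma** (A. I. Shirshov 1957; Kanel-Belov–Karasik–Rowen, *Computational Aspects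
of Polynomial Identities, Vol. I*, 2nd ed. 2015 [`KanelBelovKarasikRowen2015`], Lemma 2.3.1
with Definition 2.2.5): for all `r, m, q` there is `β = β(r, m, q)` such that every word `w` of
length `≥ β` over an alphabet of `r` letters either contains an `m`-*decomposable* subword — `m`
consecutive non-empty pieces `ws 0, …, ws (m-1)` such that every non-trivial rearrangement
`ws (σ 0) ⋯ ws (σ (m-1))`, `σ ≠ 1`, is lexicographically smaller than `ws 0 ⋯ ws (m-1)` — or
contains a subword `u^q` with `u` non-empty of length `≤ m`.  Conventions: letters are `Fin r`,
words are `List (Fin r)` in Mathlib's lexicographic order (`l < l'` is `List.Lex (· < ·) l l'`);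
the book orders decompositions the other way (`w₁⋯w_d` *greater* than its rearrangements),
which is the same statement after reversing the order of the alphabet.  All rearrangements of
the pieces have the same length, so no prefix convention intervenes.

Proof (op. cit. §2.3, the hyperword proof; everything below is proved, no named facts).
A *hyperword* is a map `h : ℕ → Fin r`; its *window* of length `t` at position `i` is the word
`(List.range' i t).map h = [h i, …, h (i+t-1)]` (lemma names say `window` for this expression);
a word `v` of length `t` is *unconfined* in `h` if `{i | (List.range' i t).map h = v}` is
infinite.
* `Shirshov.append_lt_append_of_lt`, `Shirshov.flatten_lt_flatten_of_perm`,
  `Shirshov.flatten_ofFn_perm_lt` — Remark 2.3.3 (strongly decomposable implies decomposable):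
  if the blocks are pairwise *strongly decreasing* (every continuation of a later block is
  smaller than every continuation of an earlier block), every non-identity permutation of them
  concatenates to a smaller word.
* `Shirshov.window_*` — the window calculus (splitting, shifting, heads, periodic powers).
* `Shirshov.exists_chain` — from `n` unconfined words of a common length `t ≥ 1` one cuts,
  arbitrarily far to the right, a window made of `n` non-empty pairwise strongly decreasing
  blocks (first half of the proof of Theorem 2.3.11).
* `Shirshov.periodic_of_ncard_lt` — Remark 2.3.8 and Proposition 2.3.9: a hyperword with fewer
  than `m` distinct windows of length `m` is eventually periodic with a period `p`, `1 ≤ p ≤ m`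
  (the window count `t ↦ ν t` is monotone with `ν 0 = 1`, so it has a plateau `ν t = ν (t+1)`,
  `t < m`; on a plateau a window of length `t` determines the next letter, two of the first
  `ν t + 1` positions carry the same window, and sliding gives the period `j₀ - i₀ ≤ ν t ≤ ν m`).
* `Shirshov.dichotomy` — Theorem 2.3.11 in the form needed: every hyperword has a window that
  is the concatenation of `m` non-empty pairwise strongly decreasing blocks, or is eventually
  periodic with a period `p`, `1 ≤ p ≤ m` (beyond the finitely many occurrences of the confined
  words of length `m` — `Shirshov.exists_forall_infinite_setOf_window_eq` — few unconfined
  words means few windows).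
* `Shirshov.exists_hyperword`, `Shirshov.eventually_of_hyperword` — Proposition 2.3.12 (König):
  a property of words inherited by subwords and holding for arbitrarily long words holds for
  every window of some hyperword (letters chosen one at a time by pigeonhole on `Fin r`).
* `shirshov_lemma` — apply the dichotomy to that hyperword: strongly decreasing blocks give a
  decomposable window; a period `p ≤ m` from position `N` on makes the window of length `p * q`
  at `N` the power `u^q`, `u` the window of length `p` at `N`.

No definitions are introduced (windows, unconfinedness and the window count
`Set.ncard (Set.range fun i => (List.range' i t).map h)` are Mathlib expressions).  Not here:
a value for `β(r, m, q)` (the compactness proof is ineffective; op. cit. gives Shirshov's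
original proof with an explicit bound later in Chapter 2), `d`-decomposability as a standalone
notion, and the applications (Shirshov's Height Theorem, op. cit. Theorem 2.2.2).  Mathlib
search (`lean search 'Shirshov|hyperword'`): nothing on Shirshov's theory of words in Mathlib or
in the project tree.
-/

namespace Literature.Algebra.PolynomialIdentities

namespace Shirshov

/-! ### Lexicographic comparison of equal-length words and of rearranged blocks -/

/-- If `x < y` lexicographically and `x`, `y` have the same length, then the two words already
differ inside their common length, so `x ++ s < y ++ s'` for all continuations. [folklore] -/
theorem append_lt_append_of_lt {X : Type*} [LinearOrder X] :
    ∀ {x y : List X}, x < y → x.length = y.length → ∀ s s' : List X, x ++ s < y ++ s'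
  | [], [], h, _, _, _ => (List.not_lt_nil _ h).elim
  | [], _ :: _, _, hl, _, _ => by simp at hl
  | _ :: _, [], _, hl, _, _ => by simp at hl
  | a :: x, b :: y, h, hl, s, s' => by
      simp only [List.cons_append, List.cons_lt_cons_iff] at h ⊢
      rcases h with h | ⟨rfl, h⟩
      · exact Or.inl h
      · exact Or.inr ⟨rfl, append_lt_append_of_lt h (by simpa using hl) s s'⟩

section Lex

variable {X : Type*} [LinearOrder X]

/-- A list of blocks that is pairwise *strongly decreasing* (every continuation of a later block
is lexicographically smaller than every continuation of an earlier block) dominates all its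
non-trivial rearrangements: the concatenation of any other permutation of the blocks is
lexicographically smaller (Kanel-Belov–Karasik–Rowen 2015, Remark 2.3.3: strongly decomposable
implies decomposable). [folklore] -/
theorem flatten_lt_flatten_of_perm :
    ∀ {bs cs : List (List X)},
      bs.Pairwise (fun b c : List X => ∀ s s' : List X, c ++ s < b ++ s') → cs.Perm bs →
      cs ≠ bs → cs.flatten < bs.flatten
  | [], _, _, hp, hne => (hne hp.eq_nil).elim
  | b :: bs, [], _, hp, _ => (List.cons_ne_nil b bs (hp.symm.eq_nil)).elim
  | b :: bs, c :: cs, hP, hp, hne => by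
      rw [List.pairwise_cons] at hP
      simp only [List.flatten_cons]
      by_cases hcb : c = b
      · subst hcb
        have hp' : cs.Perm bs := (List.perm_cons c).1 hp
        have hne' : cs ≠ bs := fun h => hne (by rw [h])
        exact List.Lex.append_left _ (flatten_lt_flatten_of_perm hP.2 hp' hne') c
      · have hc : c ∈ b :: bs := hp.subset List.mem_cons_self
        exact hP.1 c ((List.mem_cons.1 hc).resolve_left hcb) _ _

/-- Pieces `ws` whose list is pairwise strongly decreasing form a decomposition in the sense of
the stub: every non-identity permutation of the pieces concatenates to a lexicographically
smaller word. [folklore] -/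
theorem flatten_ofFn_perm_lt {m : ℕ} (ws : Fin m → List X)
    (hP : (List.ofFn ws).Pairwise (fun b c : List X => ∀ s s' : List X, c ++ s < b ++ s'))
    (σ : Equiv.Perm (Fin m)) (hσ : σ ≠ 1) :
    (List.ofFn (fun i => ws (σ i))).flatten < (List.ofFn ws).flatten := by
  refine flatten_lt_flatten_of_perm hP (Equiv.Perm.ofFn_comp_perm σ ws) ?_
  intro h
  have hnd : (List.ofFn ws).Nodup :=
    hP.imp fun {b c} hbc hEq => by subst hEq; exact lt_irrefl _ (hbc [] [])
  apply hσ
  ext i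
  exact congrArg Fin.val (List.nodup_ofFn.1 hnd (congrFun (List.ofFn_inj.1 h) i))

end Lex

/-! ### Windows of a hyperword -/

section Hyperword

variable {r : ℕ} (h : ℕ → Fin r)

/-- A window of length `t` has length `t`. [folklore] -/
theorem length_window (i t : ℕ) : ((List.range' i t).map h).length = t := by simp

/-- Peeling off the first letter of a window. [folklore] -/
theorem window_succ (i t : ℕ) :
    (List.range' i (t + 1)).map h = h i :: (List.range' (i + 1) t).map h := by
  rw [List.range'_succ, List.map_cons]

/-- Peeling off the last letter of a window. [folklore] -/
theorem window_succ' (i t : ℕ) :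
    (List.range' i (t + 1)).map h = (List.range' i t).map h ++ [h (i + t)] := by
  rw [List.range'_1_concat, List.map_append, List.map_singleton]

/-- Splitting a window in two. [folklore] -/
theorem window_add (i a b : ℕ) :
    (List.range' i (a + b)).map h = (List.range' i a).map h ++ (List.range' (i + a) b).map h := by
  rw [← List.range'_append_1, List.map_append]

/-- The head of a window is a window. [folklore] -/
theorem take_window_add (i t k : ℕ) :
    ((List.range' i (t + k)).map h).take t = (List.range' i t).map h := by
  rw [window_add, List.take_left' (length_window h i t)]

/-- Two windows of the same length agree iff they agree letter by letter. [folklore] -/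
theorem window_eq_window_iff (i j t : ℕ) :
    (List.range' i t).map h = (List.range' j t).map h ↔ ∀ k < t, h (i + k) = h (j + k) := by
  rw [List.ext_getElem_iff]
  simp [List.getElem_range']

/-- Windows of a shifted hyperword. [folklore] -/
theorem window_shift (N i t : ℕ) :
    (List.range' i t).map (fun n => h (N + n)) = (List.range' (N + i) t).map h := by
  rw [← List.map_add_range', List.map_map]
  rfl

/-- A window is an infix of the corresponding prefix. [folklore] -/
theorem window_infix_prefix (i t : ℕ) :
    (List.range' i t).map h <:+: (List.range' 0 (i + t)).map h :=
  ⟨(List.range' 0 i).map h, [], by rw [window_add, zero_add, List.append_nil]⟩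

/-- Under eventual periodicity `h (i + p) = h i` (`i ≥ N`), the window of length `p * q` at `N`
is the `q`-th power of the window of length `p`. [folklore] -/
theorem window_mul_eq_replicate_flatten {N p : ℕ} (hper : ∀ i, N ≤ i → h (i + p) = h i) :
    ∀ q : ℕ,
      (List.range' N (p * q)).map h = (List.replicate q ((List.range' N p).map h)).flatten
  | 0 => by simp
  | q + 1 => by
      have iter : ∀ n i, N ≤ i → h (i + p * n) = h i := by
        intro n
        induction n with
        | zero => simp
        | succ n ih =>
            intro i hi
            rw [mul_add_one, ← add_assoc, hper _ (hi.trans (Nat.le_add_right _ _)), ih i hi]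
      rw [mul_add_one, window_add, window_mul_eq_replicate_flatten hper q, List.replicate_succ',
        List.flatten_append, List.flatten_singleton]
      congr 1
      rw [window_eq_window_iff]
      intro k _
      rw [Nat.add_right_comm, iter q (N + k) (Nat.le_add_right _ _)]

/-! ### Strong decomposability from many unconfined words -/

/-- **Chains of unconfined words** (Kanel-Belov–Karasik–Rowen 2015, first half of the proof of
Theorem 2.3.11).  If `F` is a set of at least `n` words of a common length `t ≥ 1`, each of which
occurs at infinitely many positions of the hyperword `h` ("unconfined"), then beyond any position
`N` some window of `h` is the concatenation of `n` non-empty blocks whose length-`t` heads lie in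
`F` and which are pairwise strongly decreasing (take the largest word of `F` first, then recurse
on the rest of `F` further to the right). [folklore] -/
theorem exists_chain {t : ℕ} (ht : 1 ≤ t) :
    ∀ (n : ℕ) (F : Finset (List (Fin r))),
      (∀ v ∈ F, v.length = t ∧ {i | (List.range' i t).map h = v}.Infinite) →
      n ≤ F.card → ∀ N : ℕ, ∃ (P E : ℕ) (ws : Fin n → List (Fin r)), N ≤ P ∧
        (∀ i, ws i ≠ [] ∧ (ws i).take t ∈ F ∧ ((ws i).take t).length = t) ∧
        (List.ofFn ws).Pairwise (fun b c : List (Fin r) => ∀ s s' : List (Fin r),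
          c ++ s < b ++ s') ∧
        (List.range' P E).map h = (List.ofFn ws).flatten
  | 0, _, _, _, N => ⟨N, 0, Fin.elim0, le_rfl, fun i => i.elim0, by simp, by simp⟩
  | n + 1, F, hF, hcard, N => by
      classical
      have hne : F.Nonempty := Finset.card_pos.1 (by omega)
      have hvF : F.max' hne ∈ F := Finset.max'_mem F hne
      obtain ⟨hvlen, hvunc⟩ := hF _ hvF
      obtain ⟨P, hP, hNP⟩ := hvunc.exists_gt N
      have hF' : ∀ w ∈ F.erase (F.max' hne),
          w.length = t ∧ {i | (List.range' i t).map h = w}.Infinite :=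
        fun w hw => hF w (Finset.mem_of_mem_erase hw)
      have hcard' : n ≤ (F.erase (F.max' hne)).card := by
        rw [Finset.card_erase_of_mem hvF]; omega
      obtain ⟨P', E', ws', hP', hws', hPW, hsub⟩ := exists_chain ht n _ hF' hcard' (P + t)
      have htake : ((List.range' P (P' - P)).map h).take t = F.max' hne := by
        obtain ⟨k, hk⟩ : ∃ k, P' - P = t + k := ⟨P' - P - t, by omega⟩
        rw [hk, take_window_add]
        exact hP
      refine ⟨P, (P' - P) + E', Fin.cons ((List.range' P (P' - P)).map h) ws', hNP.le,
        ?_, ?_, ?_⟩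
      · refine Fin.cases ?_ ?_
        · simp only [Fin.cons_zero]
          refine ⟨?_, by rw [htake]; exact hvF, by rw [htake]; exact hvlen⟩
          intro h0
          have := congrArg List.length h0
          simp only [length_window, List.length_nil] at this
          omega
        · intro i
          simp only [Fin.cons_succ]
          obtain ⟨h1, h2, h3⟩ := hws' i
          exact ⟨h1, Finset.mem_of_mem_erase h2, h3⟩
      · rw [List.ofFn_succ]
        simp only [Fin.cons_zero, Fin.cons_succ]
        rw [List.pairwise_cons]
        refine ⟨?_, hPW⟩
        intro c hc s s'
        obtain ⟨i, rfl⟩ := List.mem_ofFn.1 hc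
        obtain ⟨_, h2, h3⟩ := hws' i
        have hlt : (ws' i).take t < F.max' hne := F.lt_max'_of_mem_erase_max' hne h2
        have e1 : ws' i ++ s = (ws' i).take t ++ ((ws' i).drop t ++ s) := by
          rw [← List.append_assoc, List.take_append_drop]
        have e2 : (List.range' P (P' - P)).map h ++ s' =
            F.max' hne ++ (((List.range' P (P' - P)).map h).drop t ++ s') := by
          rw [← htake, ← List.append_assoc, List.take_append_drop]
        rw [e1, e2]
        exact append_lt_append_of_lt hlt (by rw [h3, hvlen]) _ _
      · rw [List.ofFn_succ]
        simp only [Fin.cons_zero, Fin.cons_succ, List.flatten_cons]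
        rw [window_add, show P + (P' - P) = P' by omega, hsub]

/-! ### Few windows force periodicity -/

/-- The set of windows of length `t` of a hyperword is finite. [folklore] -/
theorem finite_range_window (t : ℕ) : (Set.range fun i => (List.range' i t).map h).Finite :=
  (List.finite_length_eq (Fin r) t).subset (by rintro _ ⟨i, rfl⟩; exact length_window h i t)

/-- Every window of length `t` is the head of a window of length `t + 1`
(Kanel-Belov–Karasik–Rowen 2015, Remark 2.3.8(i)). [folklore] -/
theorem image_take_range_window_succ (t : ℕ) :
    (fun v : List (Fin r) => v.take t) '' (Set.range fun i => (List.range' i (t + 1)).map h) =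
      Set.range fun i => (List.range' i t).map h := by
  rw [← Set.range_comp]
  congr 1
  funext i
  exact take_window_add h i t 1

/-- The number of distinct windows is monotone in the length. [folklore] -/
theorem ncard_range_window_le_succ (t : ℕ) :
    (Set.range fun i => (List.range' i t).map h).ncard ≤
      (Set.range fun i => (List.range' i (t + 1)).map h).ncard := by
  rw [← image_take_range_window_succ]
  exact Set.ncard_image_le (finite_range_window h (t + 1))

/-- There is exactly one window of length `0`. [folklore] -/
theorem ncard_range_window_zero : (Set.range fun i => (List.range' i 0).map h).ncard = 1 := by
  have : (Set.range fun i : ℕ => (List.range' i 0).map h) = {[]} := by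
    ext v
    simp
  rw [this, Set.ncard_singleton]

/-- A monotone `f : ℕ → ℕ` with `f 0 = 1` and `f m < m` has a plateau `f t = f (t + 1)` with
`t < m` (pigeonhole). [folklore] -/
theorem exists_plateau (f : ℕ → ℕ) (h0 : f 0 = 1) (hmono : ∀ t, f t ≤ f (t + 1)) {m : ℕ}
    (hm : f m < m) : ∃ t < m, f t = f (t + 1) := by
  by_contra hc
  push Not at hc
  have key : ∀ t ≤ m, t + 1 ≤ f t := by
    intro t
    induction t with
    | zero => intro; omega
    | succ t ih =>
        intro ht
        have h1 := ih (by omega)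
        have h2 := lt_of_le_of_ne (hmono t) (hc t (by omega))
        omega
  have := key m le_rfl
  omega

/-- **Determinism** (Kanel-Belov–Karasik–Rowen 2015, Remark 2.3.8(ii)): if the hyperword has as
many windows of length `t` as of length `t + 1`, then a window of length `t` determines the next
letter. [folklore] -/
theorem window_succ_eq_of_ncard_eq {t : ℕ}
    (heq : (Set.range fun i => (List.range' i t).map h).ncard =
      (Set.range fun i => (List.range' i (t + 1)).map h).ncard)
    {i j : ℕ} (hij : (List.range' i t).map h = (List.range' j t).map h) :
    (List.range' i (t + 1)).map h = (List.range' j (t + 1)).map h := by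
  have hinj := Set.injOn_of_ncard_image_eq (by rw [image_take_range_window_succ]; exact heq)
    (finite_range_window h (t + 1))
  exact hinj ⟨i, rfl⟩ ⟨j, rfl⟩ (by simpa only [take_window_add] using hij)

/-- Two of the first `μ + 1` positions carry the same window of length `t`, where `μ` is the
number of distinct windows of length `t` (pigeonhole). [folklore] -/
theorem exists_lt_window_eq (t : ℕ) :
    ∃ i₀ j₀ : ℕ, i₀ < j₀ ∧
      j₀ ≤ (Set.range fun i => (List.range' i t).map h).ncard ∧
      (List.range' i₀ t).map h = (List.range' j₀ t).map h := by
  classical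
  have hfin := finite_range_window h t
  obtain ⟨x, hx, y, hy, hxy, hfxy⟩ := Finset.exists_ne_map_eq_of_card_lt_of_maps_to
    (s := Finset.range ((Set.range fun i => (List.range' i t).map h).ncard + 1))
    (t := hfin.toFinset) (f := fun i => (List.range' i t).map h)
    (by rw [← Set.ncard_eq_toFinset_card _ hfin, Finset.card_range]; exact Nat.lt_succ_self _)
    (fun i _ => by simp)
  rw [Finset.mem_range] at hx hy
  rcases Nat.lt_or_gt_of_ne hxy with hlt | hlt
  · exact ⟨x, y, hlt, by omega, hfxy⟩
  · exact ⟨y, x, hlt, by omega, hfxy.symm⟩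

/-- Sliding a deterministic window: equal windows of length `t` at `i₀` and `j₀` propagate to
equal windows of length `t + 1` at `i₀ + s` and `j₀ + s` for all `s`. [folklore] -/
theorem window_add_eq_of_det {t : ℕ}
    (hdet : ∀ i j, (List.range' i t).map h = (List.range' j t).map h →
      (List.range' i (t + 1)).map h = (List.range' j (t + 1)).map h)
    {i₀ j₀ : ℕ} (h0 : (List.range' i₀ t).map h = (List.range' j₀ t).map h) :
    ∀ s, (List.range' (i₀ + s) (t + 1)).map h = (List.range' (j₀ + s) (t + 1)).map h
  | 0 => by simpa using hdet _ _ h0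
  | s + 1 => by
      have ih := window_add_eq_of_det hdet h0 s
      rw [window_succ, window_succ, List.cons_eq_cons] at ih
      simpa only [add_assoc] using hdet _ _ ih.2

/-- **Few windows force periodicity** (Kanel-Belov–Karasik–Rowen 2015, Proposition 2.3.9 with
Remark 2.3.8): a hyperword with fewer than `m` distinct windows of length `m` is eventually
periodic with a period `p`, `1 ≤ p ≤ m`. [folklore] -/
theorem periodic_of_ncard_lt {m : ℕ}
    (hm : (Set.range fun i => (List.range' i m).map h).ncard < m) :
    ∃ i₀ p : ℕ, 1 ≤ p ∧ p ≤ m ∧ ∀ s, h (i₀ + s + p) = h (i₀ + s) := by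
  obtain ⟨t, htm, ht⟩ :=
    exists_plateau (fun t => (Set.range fun i => (List.range' i t).map h).ncard)
      (ncard_range_window_zero h) (ncard_range_window_le_succ h) hm
  have hdet : ∀ i j, (List.range' i t).map h = (List.range' j t).map h →
      (List.range' i (t + 1)).map h = (List.range' j (t + 1)).map h :=
    fun i j hij => window_succ_eq_of_ncard_eq h ht hij
  obtain ⟨i₀, j₀, hij, hj, h0⟩ := exists_lt_window_eq h t
  have hνtm : (Set.range fun i => (List.range' i t).map h).ncard ≤
      (Set.range fun i => (List.range' i m).map h).ncard :=
    (monotone_nat_of_le_succ (ncard_range_window_le_succ h)) htm.le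
  refine ⟨i₀, j₀ - i₀, by omega, by omega, fun s => ?_⟩
  have hs := window_add_eq_of_det h hdet h0 s
  rw [window_succ, window_succ, List.cons_eq_cons] at hs
  rw [show i₀ + s + (j₀ - i₀) = j₀ + s by omega]
  exact hs.1.symm

/-! ### The dichotomy for hyperwords -/

/-- Far enough to the right, every window of length `m` of a hyperword is unconfined (occurs at
infinitely many positions): the confined words of length `m` are finitely many and each occurs
at finitely many positions. [folklore] -/
theorem exists_forall_infinite_setOf_window_eq (m : ℕ) :
    ∃ N₀ : ℕ, ∀ i, N₀ ≤ i →
      {j | (List.range' j m).map h = (List.range' i m).map h}.Infinite := by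
  have hfin : {i : ℕ |
      ({j | (List.range' j m).map h = (List.range' i m).map h} : Set ℕ).Finite}.Finite := by
    have hW : {v : List (Fin r) |
        v.length = m ∧ ({j | (List.range' j m).map h = v} : Set ℕ).Finite}.Finite :=
      (List.finite_length_eq (Fin r) m).subset fun v hv => hv.1
    refine (hW.biUnion (t := fun v => {j | (List.range' j m).map h = v}) fun v hv => hv.2).subset
      ?_
    intro i hi
    simp only [Set.mem_iUnion, Set.mem_setOf_eq, exists_prop]
    exact ⟨(List.range' i m).map h, ⟨length_window h i m, hi⟩, rfl⟩
  obtain ⟨N, hN⟩ := hfin.bddAbove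
  refine ⟨N + 1, fun i hi hc => ?_⟩
  have := mem_upperBounds.1 hN i hc
  omega

/-- **Dichotomy for hyperwords** (Kanel-Belov–Karasik–Rowen 2015, Theorem 2.3.11, in the form
needed here): every hyperword `h` either has a window that is the concatenation of `m` non-empty
pairwise strongly decreasing blocks (so `h` is strongly `m`-decomposable), or is eventually
periodic with a period `p`, `1 ≤ p ≤ m`.  Proof: if at least `m` words of length `m` are
unconfined, `exists_chain` gives the blocks; otherwise, beyond the last occurrence of a confined
word, `h` has fewer than `m` windows of length `m` and `periodic_of_ncard_lt` applies.
[cite: KanelBelovKarasikRowen2015, Theorem 2.3.11] -/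
theorem dichotomy (m : ℕ) :
    (∃ (P E : ℕ) (ws : Fin m → List (Fin r)), (∀ i, ws i ≠ []) ∧
      (List.ofFn ws).Pairwise (fun b c : List (Fin r) => ∀ s s' : List (Fin r),
        c ++ s < b ++ s') ∧
      (List.range' P E).map h = (List.ofFn ws).flatten) ∨
    (∃ N p : ℕ, 1 ≤ p ∧ p ≤ m ∧ ∀ i, N ≤ i → h (i + p) = h i) := by
  classical
  rcases Nat.eq_zero_or_pos m with rfl | hm
  · exact Or.inl ⟨0, 0, Fin.elim0, fun i => i.elim0, by simp, by simp⟩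
  set S : Set (List (Fin r)) :=
    {v | v.length = m ∧ {i | (List.range' i m).map h = v}.Infinite} with hS
  have hSfin : S.Finite := (List.finite_length_eq (Fin r) m).subset fun v hv => hv.1
  by_cases hcard : m ≤ S.ncard
  · -- many unconfined words: a strongly decreasing chain
    left
    obtain ⟨P, E, ws, -, hws, hPW, hsub⟩ := exists_chain h hm m hSfin.toFinset
      (fun v hv => (hSfin.mem_toFinset.1 hv)) (by rwa [← Set.ncard_eq_toFinset_card S hSfin]) 0
    exact ⟨P, E, ws, fun i => (hws i).1, hPW, hsub⟩
  · -- few unconfined words: eventually few windows, hence periodic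
    right
    push Not at hcard
    obtain ⟨N₀, hN₀⟩ := exists_forall_infinite_setOf_window_eq h m
    have hsub : (Set.range fun i => (List.range' i m).map (fun n => h (N₀ + n))) ⊆ S := by
      rintro _ ⟨i, rfl⟩
      show (List.range' i m).map (fun n => h (N₀ + n)) ∈ S
      rw [window_shift]
      exact ⟨length_window h _ m, hN₀ _ (Nat.le_add_right _ _)⟩
    obtain ⟨i₀, p, hp1, hpm, hper⟩ :=
      periodic_of_ncard_lt (fun n => h (N₀ + n)) ((Set.ncard_le_ncard hsub hSfin).trans_lt hcard)
    refine ⟨N₀ + i₀, p, hp1, hpm, fun i hi => ?_⟩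
    obtain ⟨s, rfl⟩ := Nat.exists_eq_add_of_le hi
    have := hper s
    simp only [add_assoc] at this ⊢
    exact this

/-! ### Compactness (König) -/

/-- **König-type compactness** (Kanel-Belov–Karasik–Rowen 2015, Proposition 2.3.12): if a
property of words that is inherited by subwords holds for words of unbounded length over the
finite alphabet `Fin r`, then it holds for every window of some hyperword.  The hyperword is built
letter by letter, keeping the invariant "the prefix has arbitrarily long good extensions"; the
next letter exists by the pigeonhole principle on the finite alphabet. [folklore] -/
theorem exists_hyperword (Good : List (Fin r) → Prop)
    (hmono : ∀ v w : List (Fin r), Good w → v <:+: w → Good v)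
    (H : ∀ N : ℕ, ∃ w, Good w ∧ N ≤ w.length) :
    ∃ g : ℕ → Fin r, ∀ i t, Good ((List.range' i t).map g) := by
  classical
  -- `T w`: `w` has arbitrarily long good extensions
  let T : List (Fin r) → Prop := fun w =>
    ∀ N : ℕ, ∃ v, Good v ∧ w <+: v ∧ N ≤ v.length
  have T_nil : T [] := fun N => (H N).imp fun v hv => ⟨hv.1, List.nil_prefix, hv.2⟩
  have T_good : ∀ w, T w → Good w := fun w hw => by
    obtain ⟨v, hv, hwv, -⟩ := hw 0
    exact hmono w v hv hwv.isInfix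
  have T_ext : ∀ w, T w → ∃ x : Fin r, T (w ++ [x]) := by
    intro w hw
    by_contra hc
    -- every one-letter extension has a bound beyond which it has no good extension
    have hc' : ∀ x : Fin r, ∃ N : ℕ, ∀ v, Good v → w ++ [x] <+: v → v.length < N := by
      intro x
      by_contra h'
      push Not at h'
      exact hc ⟨x, fun N => h' N⟩
    choose Nx hNx using hc'
    obtain ⟨v, hv, ⟨d, rfl⟩, hN⟩ := hw (Finset.univ.sup Nx + (w.length + 1))
    obtain _ | ⟨x, d⟩ := d
    · simp at hN
      omega
    · have h1 : Nx x ≤ Finset.univ.sup Nx := Finset.le_sup (Finset.mem_univ x)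
      have h2 := hNx x (w ++ x :: d) hv ⟨d, by simp⟩
      simp at hN h2
      omega
  -- choose the next letter and iterate
  choose x hx using T_ext
  obtain ⟨pre, hpre0, hpreS⟩ : ∃ pre : ℕ → {w // T w}, pre 0 = ⟨[], T_nil⟩ ∧
      ∀ n, pre (n + 1) = ⟨(pre n).1 ++ [x (pre n).1 (pre n).2], hx _ (pre n).2⟩ :=
    ⟨fun n => Nat.rec ⟨[], T_nil⟩ (fun _ w => ⟨w.1 ++ [x w.1 w.2], hx _ w.2⟩) n, rfl,
      fun _ => rfl⟩
  refine ⟨fun n => x (pre n).1 (pre n).2, fun i t => ?_⟩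
  have hprefix : ∀ n, (pre n).1 = (List.range' 0 n).map fun n => x (pre n).1 (pre n).2 := by
    intro n
    induction n with
    | zero => simp [hpre0]
    | succ n ih => rw [hpreS, window_succ', zero_add, ← ih]
  have hgood : Good ((List.range' 0 (i + t)).map fun n => x (pre n).1 (pre n).2) := by
    rw [← hprefix]
    exact T_good _ (pre (i + t)).2
  exact hmono _ _ hgood (window_infix_prefix _ i t)

/-- The contrapositive form of compactness: a property of words that is inherited by superwords
and that every hyperword exhibits in some window holds for all sufficiently long words.
[folklore] -/
theorem eventually_of_hyperword (P : List (Fin r) → Prop)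
    (hmono : ∀ v w : List (Fin r), P v → v <:+: w → P w)
    (hhyper : ∀ g : ℕ → Fin r, ∃ i t, P ((List.range' i t).map g)) :
    ∃ β : ℕ, ∀ w : List (Fin r), β ≤ w.length → P w := by
  by_contra H
  push Not at H
  obtain ⟨g, hg⟩ := exists_hyperword (fun w => ¬ P w)
    (fun v w hw hvw hv => hw (hmono v w hv hvw)) fun N => (H N).imp fun w hw => ⟨hw.2, hw.1⟩
  obtain ⟨i, t, hit⟩ := hhyper g
  exact hg i t hit

end Hyperword

end Shirshov

open Shirshov in
/-- **Shirshov's Lemma** (Shirshov 1957; Kanel-Belov–Karasik–Rowen 2015, Lemma 2.3.1 with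
Definition 2.2.5): for all `r, m, q` there is `β` such that every word `w` of length `≥ β` over
the alphabet `Fin r` either contains `m` consecutive non-empty pieces every non-trivial
rearrangement of which is lexicographically smaller than their given concatenation (an
`m`-decomposable subword), or contains a `q`-th power `u^q` of a non-empty word `u` of length
`≤ m`.  Stated verbatim as the registered stub `stub_shirshovLemma` of the consumer.  Proof
(op. cit. §2.3, hyperwords and compactness): by `eventually_of_hyperword` it suffices that every
hyperword has such a window; by `Shirshov.dichotomy`, a hyperword either has a window made of
`m` pairwise strongly decreasing blocks — decomposable by `flatten_ofFn_perm_lt` — or is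
eventually periodic with a period `p ≤ m`, and then the window of length `p * q` after the
preperiod is a `q`-th power (`window_mul_eq_replicate_flatten`).
[cite: KanelBelovKarasikRowen2015, Lemma 2.3.1] -/
theorem shirshov_lemma : ∀ r m q : ℕ, ∃ β : ℕ, ∀ w : List (Fin r), β ≤ w.length →
    (∃ (a b : List (Fin r)) (ws : Fin m → List (Fin r)), (∀ i, ws i ≠ []) ∧
      (∀ σ : Equiv.Perm (Fin m), σ ≠ 1 →
        (List.ofFn (fun i => ws (σ i))).flatten < (List.ofFn ws).flatten) ∧
      w = a ++ (List.ofFn ws).flatten ++ b) ∨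
    (∃ (a b u : List (Fin r)), u ≠ [] ∧ u.length ≤ m ∧
      w = a ++ (List.replicate q u).flatten ++ b) := by
  intro r m q
  refine eventually_of_hyperword _ ?_ ?_
  · -- both alternatives are inherited by superwords
    rintro v w (⟨a, b, ws, h1, h2, rfl⟩ | ⟨a, b, u, h1, h2, rfl⟩) ⟨s, t, rfl⟩
    · exact Or.inl ⟨s ++ a, b ++ t, ws, h1, h2, by simp [List.append_assoc]⟩
    · exact Or.inr ⟨s ++ a, b ++ t, u, h1, h2, by simp [List.append_assoc]⟩
  · -- every hyperword has a bad window
    intro g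
    rcases dichotomy g m with ⟨P, E, ws, hne, hPW, hsub⟩ | ⟨N, p, hp1, hpm, hper⟩
    · exact ⟨P, E, Or.inl ⟨[], [], ws, hne, fun σ hσ => flatten_ofFn_perm_lt ws hPW σ hσ,
        by simp [hsub]⟩⟩
    · refine ⟨N, p * q,
        Or.inr ⟨[], [], (List.range' N p).map g, ?_, by simpa using hpm, ?_⟩⟩
      · rw [← List.length_pos_iff, length_window]
        exact hp1
      · simpa using window_mul_eq_replicate_flatten g hper q

end Literature.Algebra.PolynomialIdentities
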